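import Summits.BirchSwinnertonDyer.BirchSwinnertonDyer.Theorems.EisensteinPrimesTwoVariableNotNormTwist
import Literature.NumberTheory.GaloisRepresentations.HeckeCharacterModulusExponentProofs
import Literature.NumberTheory.GaloisRepresentations.HeckeLFunctionEntireContinuationProofs
import Literature.NumberTheory.GaloisRepresentations.HeckeLFunctionNonvanishingLineProofs
import Literature.NumberTheory.GaloisRepresentations.HeckeCharacterFiniteIdeleValuesProofs
import Literature.NumberTheory.GaloisRepresentations.CMTypeHeckeCharacter
import Summits.BirchSwinnertonDyer.Rank1Residual.X11b.EmbeddingDatumPrime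
import HarnessLib

set_option linter.dupNamespace false
set_option autoImplicit false

/-!
# Crux `CycTangentCM.CycTangentBound` (stmt-BirchSwinnertonDyer-22628), stub `stub_selfDual`, frame
# uniqueness: ENTIRE CONTINUATION OF `L(χ, s)` FOR A HECKE CHARACTER OF TYPE `(−m, j)`, `j < m`
# (the `hL` of every admissible datum of the two-variable frame `IsKatzMeasure₂`)

Seat `bsd-line-ctcm-p2` (line `tangent-cone-parity`). The frame `IsKatzMeasure₂ … λ …` prescribes a value
at `(ρ, r)` only together with an entire continuation `hL` of `L(λρ, s)`; the uniqueness supplies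
(`isKatzMeasure₂_ext_of_lineSupplies`, p587325) therefore need, for every `λρ` of the typed range
(type `(−m, j)`, `0 ≤ j < m`), such a continuation. Tate's theorem
(`heckeLFunction_hasEntireContinuation_of_not_isNormTwist_holds`) is stated for UNITARY characters that
are not norm twists; this file supplies the passage (Weil's `ω = ω_σ ψ`):

* §1 `IsNormTwist.mul`, `IsNormTwist.inv` — norm twists form a subgroup.
* §2 `not_isNormTwist_of_hasInfinityType_ne` — on a totally complex `K` a character of infinity type
  `(a, b)` with `a ≠ b` is not a norm twist (`χ²·‖·‖^{a+b}` has type `(a−b, b−a)`, and the tree's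
  `not_isNormTwist_of_hasInfinityType` for type `(n, −n)`).
* §3 `norm_apply_principalInfiniteIdele_two`, `exponent_pos_of_hasInfinityType` — for `K` imaginary
  quadratic and type `(−m, j)`, `j < m`: `|χ((2)_∞)| = 2^{m−j}`, `‖(2)_∞‖ = 4`, so Weil's exponent
  `σ` (`|χ| = ‖·‖^σ`) is POSITIVE.
* §4 `hasEntireContinuation_of_hasInfinityType` — **`L(χ, s)` has an entire continuation** for such `χ`:
  `χ = χ₀·‖·‖^σ` with `χ₀` unitary and not a norm twist, `L(χ, s) = L(χ₀, s + σ)`, and the translate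
  of Tate's continuation of `L(χ₀, ·)` agrees with `L(χ, ·)` on `re s > 1` because `σ > 0`.

THEOREMS ONLY (no `def`, no fact, no `sorry`); supports, does not close, stmt-BirchSwinnertonDyer-22628.
BSD is not proved by this.

References: [WeilBNT1967] Ch. VII §3 Cor. 1–2 of Prop. 7, §7; [TateThesis1967] Thm. 4.4.1;
[deShalit1987] II.4.16 (50) (the interpolation range `0 ≤ j < −k`).
-/

noncomputable section

open scoped ComplexConjugate Classical
open NumberField IsDedekindDomain Field
open Literature.NumberTheory.GaloisRepresentations Literature.NumberTheory.EllipticCurves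
open Summit.BirchSwinnertonDyer.Rank1Residual.X11b
open Summit.BirchSwinnertonDyer.BirchSwinnertonDyer.Theorems.IwasawaTwoVariable

namespace Summit.BirchSwinnertonDyer.BirchSwinnertonDyer.Theorems.CycTangentCMCycTangentBoundInterpolationContinuation

variable {K : Type} [Field K] [NumberField K]

/-! ### §1. Norm twists form a subgroup -/

/-- **Products of norm twists are norm twists** (`‖x‖^z ‖x‖^{z'} = ‖x‖^{z+z'}`). [cite: TateThesis1967, §4.3] -/
theorem IsNormTwist.mul {χ ψ : HeckeCharacter K} (hχ : χ.IsNormTwist) (hψ : ψ.IsNormTwist) :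
    (χ * ψ).IsNormTwist := by
  obtain ⟨z, hz⟩ := hχ
  obtain ⟨z', hz'⟩ := hψ
  refine ⟨z + z', fun x ↦ ?_⟩
  have h0 : ((ideleNorm x : ℝ) : ℂ) ≠ 0 := by exact_mod_cast (HeckeCharacter.ideleNorm_pos' K x).ne'
  rw [HeckeCharacter.mul_apply, Units.val_mul, hz x, hz' x, Complex.cpow_add _ _ h0]

/-- **Inverses of norm twists are norm twists** (`(‖x‖^z)⁻¹ = ‖x‖^{−z}`). [cite: TateThesis1967, §4.3] -/
theorem IsNormTwist.inv {χ : HeckeCharacter K} (hχ : χ.IsNormTwist) : χ⁻¹.IsNormTwist := by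
  obtain ⟨z, hz⟩ := hχ
  refine ⟨-z, fun x ↦ ?_⟩
  rw [HeckeCharacter.inv_apply, Units.val_inv_eq_inv_val, hz x, Complex.cpow_neg]

/-! ### §2. Characters of unequal infinity exponents are not norm twists -/

/-- **On a totally complex field a Hecke character of infinity type `(a, b)` with `a ≠ b` is not a
norm twist.** `χ² · ‖·‖^{a+b}` has infinity type `(2a − (a+b), 2b − (a+b)) = (a − b, −(a − b))`
(`‖·‖` has type `(−1, −1)` at complex places), and would be a norm twist together with `χ`; this
contradicts `not_isNormTwist_of_hasInfinityType`. [cite: Weil1956, §1] [cite: TateThesis1967, §4.3] -/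
theorem not_isNormTwist_of_hasInfinityType_ne [IsTotallyComplex K] {χ : HeckeCharacter K} {a b : ℤ}
    (hab : a ≠ b) (h : χ.HasInfinityType (fun _ ↦ a) (fun _ ↦ b)) : ¬ χ.IsNormTwist := by
  intro hχ
  -- the norm character has type `(-1,-1)` on a totally complex field
  have hN : (HeckeCharacter.normCharacter K).HasInfinityType (fun _ ↦ (-1 : ℤ)) (fun _ ↦ (-1 : ℤ)) := by
    have h0 := HeckeCharacter.hasInfinityType_normCharacter' (K := K)
    have e : (fun w : InfinitePlace K ↦ if w.IsReal then (0 : ℤ) else -1) = fun _ ↦ (-1 : ℤ) := by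
      funext w
      rw [if_neg (InfinitePlace.not_isReal_iff_isComplex.mpr (IsTotallyComplex.isComplex w))]
    rw [e] at h0
    exact h0
  -- `χ² ‖·‖^{a+b}` has type `(a-b, -(a-b))`
  have h2 : (χ ^ (2 : ℤ) * HeckeCharacter.normCharacter K ^ (a + b)).HasInfinityType
      (fun _ ↦ (a - b)) (fun _ ↦ -(a - b)) := by
    have := (h.zpow' 2).mul' (hN.zpow' (a + b))
    convert this using 2 <;> simp only [Pi.add_apply, Pi.smul_apply, smul_eq_mul] <;> ring
  have hnt : (χ ^ (2 : ℤ) * HeckeCharacter.normCharacter K ^ (a + b)).IsNormTwist := by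
    have hχ2 : (χ ^ (2 : ℤ)).IsNormTwist := by
      rw [show (2 : ℤ) = 1 + 1 by norm_num, zpow_add, zpow_one]
      exact IsNormTwist.mul hχ hχ
    refine IsNormTwist.mul hχ2 ?_
    -- integral powers of the norm character
    have hNt : (HeckeCharacter.normCharacter K).IsNormTwist := HeckeCharacter.isNormTwist_normCharacter K
    have hpow : ∀ n : ℕ, (HeckeCharacter.normCharacter K ^ n).IsNormTwist := fun n ↦ by
      induction n with
      | zero => exact ⟨0, fun x ↦ by simp⟩
      | succ n ih => rw [pow_succ]; exact IsNormTwist.mul ih hNt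
    rcases Int.eq_nat_or_neg (a + b) with ⟨n, hn | hn⟩
    · rw [hn, zpow_natCast]; exact hpow n
    · rw [hn, zpow_neg, zpow_natCast]; exact IsNormTwist.inv (hpow n)
  exact not_isNormTwist_of_hasInfinityType (sub_ne_zero.mpr hab) h2 hnt

/-! ### §3. The exponent of a character of type `(−m, j)`, `j < m`, is positive -/

/-- **`|χ((2)_∞)| = 2^{m − j}`** for `χ` of type `(−m, j)` on an imaginary quadratic field, at the
principal infinite idele of `2`. [cite: WeilBNT1967, Ch. VII §3] -/
theorem norm_apply_principalInfiniteIdele_two (hK : IsImaginaryQuadratic K) {χ : HeckeCharacter K}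
    {m j : ℕ} (h : χ.HasInfinityType (fun _ ↦ -(m : ℤ)) (fun _ ↦ (j : ℤ))) :
    ‖((χ (infiniteIdeles K (globalToInfiniteUnits K (Units.mk0 (2 : K) two_ne_zero))) : ℂˣ) : ℂ)‖ =
      (2 : ℝ) ^ ((m : ℤ) - j) := by
  haveI : IsTotallyComplex K := hK.2
  haveI := subsingleton_infinitePlace_of_isImaginaryQuadratic hK
  obtain ⟨w₀⟩ : Nonempty (InfinitePlace K) := inferInstance
  rw [h.apply_globalToInfiniteUnits_eq_of_isTotallyComplex, Fintype.prod_subsingleton _ w₀,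
    Units.val_mk0, map_ofNat, map_ofNat, neg_neg, norm_mul, norm_zpow, norm_zpow,
    Complex.norm_ofNat, ← zpow_add₀ (by norm_num : (2 : ℝ) ≠ 0)]
  ring_nf

/-- **`‖(2)_∞‖ = 4`** on an imaginary quadratic field (one complex place, `|2|_ℂ² = 4`).
[cite: WeilBNT1967, Ch. IV §4] -/
theorem ideleNorm_principalInfiniteIdele_two (hK : IsImaginaryQuadratic K) :
    ideleNorm (infiniteIdeles K (globalToInfiniteUnits K (Units.mk0 (2 : K) two_ne_zero))) = 4 := by
  haveI : IsTotallyComplex K := hK.2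
  haveI := subsingleton_infinitePlace_of_isImaginaryQuadratic hK
  obtain ⟨w₀⟩ : Nonempty (InfinitePlace K) := inferInstance
  have hN := (HeckeCharacter.hasInfinityType_normCharacter' (K := K)).apply_globalToInfiniteUnits_eq_of_isTotallyComplex
    (Units.mk0 (2 : K) two_ne_zero)
  rw [HeckeCharacter.normCharacter_apply, Fintype.prod_subsingleton _ w₀, Units.val_mk0,
    map_ofNat, map_ofNat] at hN
  have hw₀ : ¬ w₀.IsReal := InfinitePlace.not_isReal_iff_isComplex.mpr (IsTotallyComplex.isComplex w₀)
  rw [if_neg hw₀] at hN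
  norm_num at hN
  exact_mod_cast hN

/-- **The Weil exponent of a character of type `(−m, j)`, `j < m`, is positive**: if `|χ| = ‖·‖^σ`
then `4^σ = 2^{m−j} > 1`, so `σ > 0`. [cite: WeilBNT1967, Ch. VII §3 Cor. 1–2 of Prop. 7] -/
theorem exponent_pos_of_hasInfinityType (hK : IsImaginaryQuadratic K) {χ : HeckeCharacter K}
    {m j : ℕ} (hjm : j < m) (h : χ.HasInfinityType (fun _ ↦ -(m : ℤ)) (fun _ ↦ (j : ℤ)))
    {σ : ℝ} (hσ : ∀ x : ideleGroup K, ‖((χ x : ℂˣ) : ℂ)‖ = ideleNorm x ^ σ) : 0 < σ := by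
  have h1 := hσ (infiniteIdeles K (globalToInfiniteUnits K (Units.mk0 (2 : K) two_ne_zero)))
  rw [norm_apply_principalInfiniteIdele_two hK h, ideleNorm_principalInfiniteIdele_two hK] at h1
  by_contra hle
  push Not at hle
  have hlt : (1 : ℝ) < (2 : ℝ) ^ ((m : ℤ) - j) := one_lt_zpow₀ (by norm_num) (by omega)
  have hge : (4 : ℝ) ^ σ ≤ 1 := Real.rpow_le_one_of_one_le_of_nonpos (by norm_num) hle
  linarith

/-! ### §4. The entire continuation -/

/-- **`L(χ, s)` has an entire continuation for `χ` of infinity type `(−m, j)`, `j < m`, on an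
imaginary quadratic field** (the `hL` of every admissible datum of `IsKatzBranch` /
`IsKatzMeasure₂`): Weil's decomposition `χ = χ₀ · ‖·‖^σ` with `χ₀` unitary; `χ₀` is not a norm
twist (else `χ` would be one, contradicting §2 since `−m ≠ j`); Tate's continuation `g₀` of
`L(χ₀, ·)` translated by `σ`, `g(s) = g₀(s + σ)`, is entire and agrees with
`L(χ, s) = L(χ₀, s + σ)` on `re s > 1` because `σ > 0` (§3).
[cite: TateThesis1967, Thm. 4.4.1] [cite: WeilBNT1967, Ch. VII §3 and §7] -/
theorem hasEntireContinuation_of_hasInfinityType (hK : IsImaginaryQuadratic K) {χ : HeckeCharacter K}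
    {m j : ℕ} (hjm : j < m) (h : χ.HasInfinityType (fun _ ↦ -(m : ℤ)) (fun _ ↦ (j : ℤ))) :
    LFunction.HasEntireContinuation (heckeLFunction χ) := by
  haveI : IsTotallyComplex K := hK.2
  obtain ⟨σ, χ₀, ν, h₀, hσ, hν, hχ⟩ := χ.exists_isUnitary_mul_normPow
  have hνt : ν.IsNormTwist := ⟨σ, hν⟩
  have hnt : ¬ χ₀.IsNormTwist := by
    intro h0
    have : χ.IsNormTwist := by rw [hχ]; exact IsNormTwist.mul h0 hνt
    exact not_isNormTwist_of_hasInfinityType_ne (by omega) h this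
  obtain ⟨g₀, hg₀, hg₀L⟩ := heckeLFunction_hasEntireContinuation_of_not_isNormTwist_holds χ₀ h₀ hnt
  have hpos : 0 < σ := exponent_pos_of_hasInfinityType hK hjm h hσ
  refine ⟨fun s ↦ g₀ (s + σ), hg₀.comp (differentiable_id.add_const _), fun s hs ↦ ?_⟩
  show g₀ (s + σ) = heckeLFunction χ s
  rw [HeckeCharacter.heckeLFunction_eq_unitaryPart_translate hν hχ s, hg₀L (s + σ)]
  rw [Complex.add_re, Complex.ofReal_re]
  linarith

end Summit.BirchSwinnertonDyer.BirchSwinnertonDyer.Theorems.CycTangentCMCycTangentBoundInterpolationContinuation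

end
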